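import Mathlib

/-!
# `TateLifting` (stmt-KontsevichZagierPeriods-9129), line `Sketch` — stub 53 `IsotropySpace`,
# auxiliary file 1: the `9 × 9` block Jacobian and the rational rotation frame of `S²`

Auxiliary lemmas for `Theorems/InverseLandauTateLiftingIsotropySpace.lean` (the space engine of
hard-sphere cluster integrals = `IsotropyFactorisation3` of route HardSphereVirial: one rule-(2) move
of the Kontsevich–Zagier calculus along the chart
`Ψ(a, b, ρ, y₃, y₄) = (ρ ω(a,b), M(a,b) y₃, M(a,b) y₄)` of `(ℝ³)³`):

* the `9 × 9` Jacobian of `Ψ` in block form `(A, 0; C, M ⊕ M)` (`Matrix.fromBlocks` along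
  `finSumFinEquiv : Fin 3 ⊕ Fin 6 ≃ Fin 9` and `Fin 3 ⊕ Fin 3 ≃ Fin 6`): its determinant
  `det A · (det M)²` (`det_blockJac`) and its action on vectors (`blockJac_mulVec`);
* the inverse-stereographic direction `ω = (p, q, t) = (2a, 2b, 1 − a² − b²)/(1 + a² + b²)` and the
  RATIONAL rotation frame `M = (e, g, p; g, f, q; p, q, t)`, `e = (a² − b² − 1)/(1 + a² + b²)`,
  `f = (b² − a² − 1)/(1 + a² + b²)`, `g = 2ab/(1 + a² + b²)` (`M = 2uuᵀ − I`, `u ∝ (a, b, 1)`: the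
  rotation by `π` about `u`), kept abstract as functions `p q t e f g : ℝ → ℝ → ℝ` constrained by
  their defining equations: `Mᵀ M = 1`, `det M = 1`, `M e₃ = ω`, injectivity of `(a, b) ↦ ω` with the
  left inverse `a = p/(1 + t)`, `b = q/(1 + t)`, and spherical coordinates off the closed southern
  axis (`polar_exists`: `x = ρ ω(a, b)`, `ρ = |x|`, `(a, b) = (x₀, x₁)/(ρ + x₂)`).

No definitions are introduced (pure proof file). References: M. Kontsevich, D. Zagier, *Periods*
(2001), §1.2 rule (2); the rest is folklore linear algebra (Cayley's rational parametrisation of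
rotations, stereographic projection).
-/

noncomputable section

namespace Summit.KontsevichZagierPeriods.InverseLandau

namespace IsotropySpace

/-! ### Linear algebra of the block Jacobian -/

/-- `finSumFinEquiv.symm` on `Fin 9 = Fin (3 + 6)`, evaluated. [folklore] -/
theorem finSumFinEquiv_symm_nine (k : Fin 9) : (finSumFinEquiv.symm k : Fin 3 ⊕ Fin 6) =
    (![Sum.inl 0, Sum.inl 1, Sum.inl 2, Sum.inr 0, Sum.inr 1, Sum.inr 2, Sum.inr 3, Sum.inr 4,
      Sum.inr 5] : Fin 9 → Fin 3 ⊕ Fin 6) k := by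
  revert k
  decide

/-- `finSumFinEquiv.symm` on `Fin 6 = Fin (3 + 3)`, evaluated. [folklore] -/
theorem finSumFinEquiv_symm_six (k : Fin 6) : (finSumFinEquiv.symm k : Fin 3 ⊕ Fin 3) =
    (![Sum.inl 0, Sum.inl 1, Sum.inl 2, Sum.inr 0, Sum.inr 1, Sum.inr 2] : Fin 6 → Fin 3 ⊕ Fin 3) k := by
  revert k
  decide

/-- Determinant of the block lower-triangular `9 × 9` matrix `(A, 0; C, M ⊕ M)`: `det A · (det M)²`.
[folklore] -/
theorem det_blockJac (A : Matrix (Fin 3) (Fin 3) ℝ) (C : Matrix (Fin 6) (Fin 3) ℝ)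
    (M : Matrix (Fin 3) (Fin 3) ℝ) :
    (Matrix.reindex finSumFinEquiv finSumFinEquiv
        (Matrix.fromBlocks A 0 C
          (Matrix.reindex finSumFinEquiv finSumFinEquiv (Matrix.fromBlocks M 0 0 M))) :
        Matrix (Fin 9) (Fin 9) ℝ).det = A.det * M.det ^ 2 := by
  rw [Matrix.det_reindex_self, Matrix.det_fromBlocks_zero₁₂, Matrix.det_reindex_self,
    Matrix.det_fromBlocks_zero₁₂]
  ring

/-- The block lower-triangular `9 × 9` matrix `(A, 0; C, M ⊕ M)` applied to a vector. [folklore] -/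
theorem blockJac_mulVec (A : Matrix (Fin 3) (Fin 3) ℝ) (C : Matrix (Fin 6) (Fin 3) ℝ)
    (M : Matrix (Fin 3) (Fin 3) ℝ) (v : Fin 9 → ℝ) :
    (Matrix.reindex finSumFinEquiv finSumFinEquiv
        (Matrix.fromBlocks A 0 C
          (Matrix.reindex finSumFinEquiv finSumFinEquiv (Matrix.fromBlocks M 0 0 M))) :
        Matrix (Fin 9) (Fin 9) ℝ).mulVec v =
      ![A 0 0 * v 0 + A 0 1 * v 1 + A 0 2 * v 2,
        A 1 0 * v 0 + A 1 1 * v 1 + A 1 2 * v 2,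
        A 2 0 * v 0 + A 2 1 * v 1 + A 2 2 * v 2,
        C 0 0 * v 0 + C 0 1 * v 1 + C 0 2 * v 2 + (M 0 0 * v 3 + M 0 1 * v 4 + M 0 2 * v 5),
        C 1 0 * v 0 + C 1 1 * v 1 + C 1 2 * v 2 + (M 1 0 * v 3 + M 1 1 * v 4 + M 1 2 * v 5),
        C 2 0 * v 0 + C 2 1 * v 1 + C 2 2 * v 2 + (M 2 0 * v 3 + M 2 1 * v 4 + M 2 2 * v 5),
        C 3 0 * v 0 + C 3 1 * v 1 + C 3 2 * v 2 + (M 0 0 * v 6 + M 0 1 * v 7 + M 0 2 * v 8),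
        C 4 0 * v 0 + C 4 1 * v 1 + C 4 2 * v 2 + (M 1 0 * v 6 + M 1 1 * v 7 + M 1 2 * v 8),
        C 5 0 * v 0 + C 5 1 * v 1 + C 5 2 * v 2 + (M 2 0 * v 6 + M 2 1 * v 7 + M 2 2 * v 8)] := by
  funext i
  fin_cases i <;> simp [Matrix.mulVec, dotProduct, Fin.sum_univ_succ, finSumFinEquiv_symm_nine,
    finSumFinEquiv_symm_six] <;> ring

/-- A `3 × 3` matrix applied to a vector. [folklore] -/
theorem mulVec_three (M : Matrix (Fin 3) (Fin 3) ℝ) (a b c : ℝ) :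
    M.mulVec ![a, b, c] = ![M 0 0 * a + M 0 1 * b + M 0 2 * c, M 1 0 * a + M 1 1 * b + M 1 2 * c,
      M 2 0 * a + M 2 1 * b + M 2 2 * c] := by
  funext i
  fin_cases i <;> simp [Matrix.mulVec, dotProduct, Fin.sum_univ_three]

/-! ### The rational rotation frame of the sphere -/

section Frame

variable {p q t e f g : ℝ → ℝ → ℝ}
  (hp : ∀ a b, p a b = 2 * a / (1 + a ^ 2 + b ^ 2))
  (hq : ∀ a b, q a b = 2 * b / (1 + a ^ 2 + b ^ 2))
  (ht : ∀ a b, t a b = (1 - a ^ 2 - b ^ 2) / (1 + a ^ 2 + b ^ 2))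
  (he : ∀ a b, e a b = (a ^ 2 - b ^ 2 - 1) / (1 + a ^ 2 + b ^ 2))
  (hf : ∀ a b, f a b = (b ^ 2 - a ^ 2 - 1) / (1 + a ^ 2 + b ^ 2))
  (hg : ∀ a b, g a b = 2 * a * b / (1 + a ^ 2 + b ^ 2))

include hp hq ht in
/-- `ω = (p, q, t)` lies on the unit sphere. [folklore] -/
theorem sphere_sq_add_sq (a b : ℝ) : p a b ^ 2 + q a b ^ 2 + t a b ^ 2 = 1 := by
  rw [hp, hq, ht]
  have h : (1 : ℝ) + a ^ 2 + b ^ 2 ≠ 0 := by positivity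
  field_simp
  ring

include ht in
/-- `1 + t > 0`: the direction `ω` never is the south pole. [folklore] -/
theorem one_add_t_pos (a b : ℝ) : 0 < 1 + t a b := by
  rw [ht]
  have h : (0 : ℝ) < 1 + a ^ 2 + b ^ 2 := by positivity
  have e1 : (1 : ℝ) + (1 - a ^ 2 - b ^ 2) / (1 + a ^ 2 + b ^ 2) = 2 / (1 + a ^ 2 + b ^ 2) := by
    field_simp
    ring
  rw [e1]
  positivity

include hp ht in
/-- Left inverse of the stereographic chart, first coordinate: `p/(1 + t) = a`. [folklore] -/
theorem p_div_one_add_t (a b : ℝ) : p a b / (1 + t a b) = a := by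
  rw [hp, ht]
  have h : (1 : ℝ) + a ^ 2 + b ^ 2 ≠ 0 := by positivity
  rw [div_eq_iff (by rw [← ht]; exact (one_add_t_pos ht a b).ne')]
  field_simp
  ring

include hq ht in
/-- Left inverse of the stereographic chart, second coordinate: `q/(1 + t) = b`. [folklore] -/
theorem q_div_one_add_t (a b : ℝ) : q a b / (1 + t a b) = b := by
  rw [hq, ht]
  have h : (1 : ℝ) + a ^ 2 + b ^ 2 ≠ 0 := by positivity
  rw [div_eq_iff (by rw [← ht]; exact (one_add_t_pos ht a b).ne')]
  field_simp
  ring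

include hp hq ht in
/-- The stereographic parametrisation is injective. [folklore] -/
theorem stereo_inj {a b a' b' : ℝ} (h1 : p a b = p a' b') (h2 : q a b = q a' b') (h3 : t a b = t a' b') :
    a = a' ∧ b = b' := by
  constructor
  · rw [← p_div_one_add_t hp ht a b, ← p_div_one_add_t hp ht a' b', h1, h3]
  · rw [← q_div_one_add_t hq ht a b, ← q_div_one_add_t hq ht a' b', h2, h3]

include hp hq ht in
/-- The stereographic parametrisation is onto the sphere minus the south pole:
`ω(n₀/(1+n₂), n₁/(1+n₂)) = n` for `|n| = 1`, `n₂ ≠ −1`. [folklore] -/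
theorem stereo_surj {n₀ n₁ n₂ : ℝ} (h : n₀ ^ 2 + n₁ ^ 2 + n₂ ^ 2 = 1) (hn : n₂ ≠ -1) :
    p (n₀ / (1 + n₂)) (n₁ / (1 + n₂)) = n₀ ∧ q (n₀ / (1 + n₂)) (n₁ / (1 + n₂)) = n₁ ∧
      t (n₀ / (1 + n₂)) (n₁ / (1 + n₂)) = n₂ := by
  have hn1 : 1 + n₂ ≠ 0 := fun h' => hn (by linarith)
  have hu : (1 : ℝ) + (n₀ / (1 + n₂)) ^ 2 + (n₁ / (1 + n₂)) ^ 2 ≠ 0 := by positivity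
  refine ⟨?_, ?_, ?_⟩
  · rw [hp, div_eq_iff hu]
    field_simp
    linear_combination (-n₀) * h
  · rw [hq, div_eq_iff hu]
    field_simp
    linear_combination (-n₁) * h
  · rw [ht, div_eq_iff hu]
    field_simp
    linear_combination (-(1 + n₂)) * h

include hp hq ht in
/-- Spherical coordinates off the closed southern axis: for `¬(x₀ = 0 ∧ x₁ = 0 ∧ x₂ ≤ 0)` there are
`a, b` and `ρ > 0` with `x = ρ ω(a, b)` (`ρ = |x|`, `(a, b) = (x₀, x₁)/(ρ + x₂)`). [folklore] -/
theorem polar_exists (x₀ x₁ x₂ : ℝ) (h : ¬(x₀ = 0 ∧ x₁ = 0 ∧ x₂ ≤ 0)) :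
    ∃ a b ρ : ℝ, 0 < ρ ∧ x₀ = ρ * p a b ∧ x₁ = ρ * q a b ∧ x₂ = ρ * t a b := by
  set ρ := Real.sqrt (x₀ ^ 2 + x₁ ^ 2 + x₂ ^ 2) with hρ_def
  have hρ0 : 0 ≤ ρ := Real.sqrt_nonneg _
  have hρ2 : ρ ^ 2 = x₀ ^ 2 + x₁ ^ 2 + x₂ ^ 2 := Real.sq_sqrt (by positivity)
  have hρ : 0 < ρ := by
    rcases hρ0.lt_or_eq with hlt | heq
    · exact hlt
    · exfalso
      rw [← heq] at hρ2
      have h0 : x₀ ^ 2 = 0 := by nlinarith [sq_nonneg x₀, sq_nonneg x₁, sq_nonneg x₂]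
      have h1 : x₁ ^ 2 = 0 := by nlinarith [sq_nonneg x₀, sq_nonneg x₁, sq_nonneg x₂]
      have h2 : x₂ ^ 2 = 0 := by nlinarith [sq_nonneg x₀, sq_nonneg x₁, sq_nonneg x₂]
      exact h ⟨pow_eq_zero_iff two_ne_zero |>.1 h0, pow_eq_zero_iff two_ne_zero |>.1 h1,
        (pow_eq_zero_iff two_ne_zero |>.1 h2).le⟩
  have hn : x₂ / ρ ≠ -1 := by
    intro hx
    rw [div_eq_iff hρ.ne'] at hx
    have h0 : x₀ ^ 2 = 0 := by nlinarith [hρ2, sq_nonneg x₀, sq_nonneg x₁]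
    have h1 : x₁ ^ 2 = 0 := by nlinarith [hρ2, sq_nonneg x₀, sq_nonneg x₁]
    exact h ⟨pow_eq_zero_iff two_ne_zero |>.1 h0, pow_eq_zero_iff two_ne_zero |>.1 h1, by nlinarith⟩
  have h1 : (x₀ / ρ) ^ 2 + (x₁ / ρ) ^ 2 + (x₂ / ρ) ^ 2 = 1 := by
    field_simp
    linear_combination -hρ2
  obtain ⟨hpu, hqu, htu⟩ := stereo_surj hp hq ht h1 hn
  refine ⟨x₀ / ρ / (1 + x₂ / ρ), x₁ / ρ / (1 + x₂ / ρ), ρ, hρ, ?_, ?_, ?_⟩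
  · rw [hpu]; field_simp
  · rw [hqu]; field_simp
  · rw [htu]; field_simp

include hp hq ht he hf hg in
/-- The frame is orthogonal: `Mᵀ M = 1` for `M = (e, g, p; g, f, q; p, q, t)`. [folklore] -/
theorem frame_transpose_mul_self (a b : ℝ) :
    (!![e a b, g a b, p a b; g a b, f a b, q a b; p a b, q a b, t a b] : Matrix (Fin 3) (Fin 3) ℝ).transpose *
      !![e a b, g a b, p a b; g a b, f a b, q a b; p a b, q a b, t a b] = 1 := by
  have h : (1 : ℝ) + a ^ 2 + b ^ 2 ≠ 0 := by positivity
  ext i j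
  fin_cases i <;> fin_cases j <;>
    simp [Matrix.mul_apply, Fin.sum_univ_three, hp, hq, ht, he, hf, hg] <;> field_simp <;> ring

include hp hq ht he hf hg in
/-- The frame is symmetric and orthogonal, hence also `M Mᵀ = 1`. [folklore] -/
theorem frame_mul_transpose_self (a b : ℝ) :
    (!![e a b, g a b, p a b; g a b, f a b, q a b; p a b, q a b, t a b] : Matrix (Fin 3) (Fin 3) ℝ) *
      (!![e a b, g a b, p a b; g a b, f a b, q a b; p a b, q a b, t a b]).transpose = 1 := by
  have hT : (!![e a b, g a b, p a b; g a b, f a b, q a b; p a b, q a b, t a b] :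
      Matrix (Fin 3) (Fin 3) ℝ).transpose = !![e a b, g a b, p a b; g a b, f a b, q a b; p a b, q a b, t a b] := by
    ext i j; fin_cases i <;> fin_cases j <;> rfl
  rw [hT]
  nth_rewrite 1 [← hT]
  exact frame_transpose_mul_self hp hq ht he hf hg a b

include hp hq ht he hf hg in
/-- The frame is a rotation: `det M = 1`. [folklore] -/
theorem frame_det (a b : ℝ) :
    (!![e a b, g a b, p a b; g a b, f a b, q a b; p a b, q a b, t a b] : Matrix (Fin 3) (Fin 3) ℝ).det = 1 := by
  have h : (1 : ℝ) + a ^ 2 + b ^ 2 ≠ 0 := by positivity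
  rw [Matrix.det_fin_three]
  simp only [Matrix.of_apply, Matrix.cons_val', Matrix.cons_val_zero, Matrix.cons_val_one,
    Matrix.cons_val_two, Matrix.empty_val', Matrix.cons_val_fin_one, Matrix.head_cons,
    Matrix.head_fin_const, Matrix.tail_cons, hp, hq, ht, he, hf, hg]
  field_simp
  ring

/-- The frame takes the north pole to the direction `ω`: `M (0, 0, ρ) = ρ ω`. [folklore] -/
theorem frame_mulVec_axis (a b ρ : ℝ) :
    (!![e a b, g a b, p a b; g a b, f a b, q a b; p a b, q a b, t a b] : Matrix (Fin 3) (Fin 3) ℝ).mulVec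
      ![0, 0, ρ] = ![ρ * p a b, ρ * q a b, ρ * t a b] := by
  rw [mulVec_three]
  simp only [Matrix.of_apply, Matrix.cons_val', Matrix.cons_val_zero, Matrix.cons_val_one,
    Matrix.cons_val_two, Matrix.empty_val', Matrix.cons_val_fin_one, Matrix.head_cons,
    Matrix.head_fin_const, Matrix.tail_cons]
  funext i
  fin_cases i <;> simp <;> ring

end Frame

end IsotropySpace

/-- **Registered auxiliary sub-goal of stub 53 `IsotropySpace` (spherical coordinates through the
rational stereographic frame).** Off the closed southern axis, every point of `ℝ³` is `ρ ω(a, b)` with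
`ρ > 0` and `ω(a, b) = (2a, 2b, 1 − a² − b²)/(1 + a² + b²)` (`ρ = |x|`, `(a, b) = (x₀, x₁)/(ρ + x₂)` —
the inverse of the chart of the space engine; `IsotropySpace.polar_exists`). [folklore] -/
theorem tateLifting_isotropySpacePolar :
    ∀ (x₀ x₁ x₂ : ℝ), ¬(x₀ = 0 ∧ x₁ = 0 ∧ x₂ ≤ 0) →
      ∃ a b ρ : ℝ, 0 < ρ ∧ x₀ = ρ * (2 * a / (1 + a ^ 2 + b ^ 2)) ∧
        x₁ = ρ * (2 * b / (1 + a ^ 2 + b ^ 2)) ∧ x₂ = ρ * ((1 - a ^ 2 - b ^ 2) / (1 + a ^ 2 + b ^ 2)) :=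
  fun x₀ x₁ x₂ h => IsotropySpace.polar_exists (p := fun a b => 2 * a / (1 + a ^ 2 + b ^ 2))
    (q := fun a b => 2 * b / (1 + a ^ 2 + b ^ 2))
    (t := fun a b => (1 - a ^ 2 - b ^ 2) / (1 + a ^ 2 + b ^ 2))
    (fun _ _ => rfl) (fun _ _ => rfl) (fun _ _ => rfl) x₀ x₁ x₂ h

end Summit.KontsevichZagierPeriods.InverseLandau

end
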